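import Literature.MathematicalPhysics.QuantumLattice.QuantumRotorTruncated
import Literature.MathematicalPhysics.QuantumLattice.XYOrderInfraredProofs
import Mathlib.Algebra.Lie.OfAssociative
import HarnessLib

/-!
# Truncated quantum rotators: the double commutator `[A, [H_M, A]]` and the truncation edge

Sibling file of `QuantumRotorTruncated.lean` (item
`provefact-Literature.MathematicalPhysics.QuantumLa-0bccfc6de5`, the named fact
`QuantumRotor.KleinPerez1992_rotorGroundStateLRO`). No statement is touched. This file supplies the
"double commutator" input of the Kennedy–Lieb–Shastry `T = 0` infrared bound
([KLS1988JSP] eq. (13); for the rotators: [WojtkiewiczPuszStachura2016] §3.4, the bound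
`𝓓_k ≤ 1/(4I)` from `[cos φ_x, [-(1/2I)∂²_x, cos φ_x]] = (1/I) sin² φ_x`) for the Galerkin matrices
`H_M` of `QuantumRotorTruncated.lean`, where the compressed `cos` and `sin` no longer commute and
the identity acquires **edge terms** supported on the extreme momenta `|n| = M`:

* one rotator: `N P_M = M P_M`, `N P_{-M} = -M P_{-M}`, `P_M P_{-M} = 0` (`M ≥ 1`),
  `[N, cos] = i sin`, `[cos, sin] = (i/2)(P_M - P_{-M})`, and the exact kinetic double commutator
  **`[cos, [N², cos]] = 2 sin² - M (P_M + P_{-M})`** (`truncCos_doubleCommutator`; continuum: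
  `2 sin²`);
* many rotators: for a "wave" `A = Σ_u a_u cos_u` and the compressed Hamiltonian
  `H_M = Σ_x (h/2) N_x² - (J/2) Σ_x Σ_{y ∼ x} (cos_x cos_y + sin_x sin_y)` over an irreflexive
  neighbour relation, the exact formula (`lie_lie_truncHamiltonian`)
  `[A, [H_M, A]] = Σ_x (h/2) a_x² (2 sin_x² - M Π_x)
    + (J/2) Σ_x Σ_{y ∼ x} (a_x² [cos_x, E_x] sin_y + a_y² sin_x [cos_y, E_y] + 2 a_x a_y E_x E_y)`,
  `E_x = [cos_x, sin_x]`, `Π_x = P^x_M + P^x_{-M}` (continuum: the `J`-terms vanish);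
* the operator inequalities that control these terms in any state (`M ≥ 1`):
  `sin² ≤ 1`, `cos² ≤ 1`, `2 sin_x² - M Π_x ≤ 2`,
  `±([cos_x, E_x] sin_y) ≤ ε + Π_x/(4ε)` (`ε > 0`), `±(E_x E_y) ≤ (Π_x + Π_y)/8` (`x ≠ y`),
  all as `Matrix.PosSemidef` statements.

## References

* [KLS1988JSP] T. Kennedy, E. H. Lieb, B. S. Shastry, J. Stat. Phys. 53 (1988) 1019–1030,
  eq. (13).
* [WojtkiewiczPuszStachura2016] J. Wojtkiewicz, W. Pusz, P. Stachura, Rep. Math. Phys. 77 (2016)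
  183–209 (arXiv:1507.03079), §3.4.
-/

noncomputable section

open Matrix Complex Finset
open scoped ComplexOrder

namespace Literature.MathematicalPhysics.QuantumLattice

namespace QuantumRotor

-- the commutator bracket `⁅a, b⁆ = ab - ba` of an associative ring (Mathlib idiom, local)
attribute [local instance 100] LieRing.ofAssociativeRing

/-! ### One rotator -/

section Local

variable (M : ℕ)

/-- `N P_M = M P_M`. [folklore] -/
theorem truncMomentum_mul_truncTop : truncMomentum M * truncTop M = (M : ℂ) • truncTop M := by
  rw [truncMomentum, truncTop, diagonal_mul_diagonal, smul_eq_diagonal_mul, diagonal_mul_diagonal]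
  congr 1
  funext a
  by_cases h : a = Fin.last (2 * M)
  · rw [if_pos h, h, Fin.val_last, mul_one, mul_one]
    push_cast
    ring
  · rw [if_neg h, mul_zero, mul_zero]

/-- `P_M N = M P_M`. [folklore] -/
theorem truncTop_mul_truncMomentum : truncTop M * truncMomentum M = (M : ℂ) • truncTop M := by
  have h := congrArg transpose (truncMomentum_mul_truncTop M)
  rwa [transpose_mul, truncMomentum_transpose, truncTop_transpose, transpose_smul,
    truncTop_transpose] at h

/-- `N P_{-M} = -M P_{-M}`. [folklore] -/
theorem truncMomentum_mul_truncBot : truncMomentum M * truncBot M = (-(M : ℂ)) • truncBot M := by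
  rw [truncMomentum, truncBot, diagonal_mul_diagonal, smul_eq_diagonal_mul, diagonal_mul_diagonal]
  congr 1
  funext a
  by_cases h : a = 0
  · rw [if_pos h, h, Fin.val_zero, mul_one, mul_one, Nat.cast_zero, zero_sub]
  · rw [if_neg h, mul_zero, mul_zero]

/-- `P_{-M} N = -M P_{-M}`. [folklore] -/
theorem truncBot_mul_truncMomentum : truncBot M * truncMomentum M = (-(M : ℂ)) • truncBot M := by
  have h := congrArg transpose (truncMomentum_mul_truncBot M)
  rwa [transpose_mul, truncMomentum_transpose, truncBot_transpose, transpose_smul,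
    truncBot_transpose] at h

/-- `P_M P_{-M} = 0` for `M ≥ 1` (distinct extreme states). [folklore] -/
theorem truncTop_mul_truncBot (hM : 1 ≤ M) : truncTop M * truncBot M = 0 := by
  rw [truncTop, truncBot, diagonal_mul_diagonal, ← diagonal_zero]
  congr 1
  funext a
  by_cases h0 : a = 0
  · have hl : a ≠ Fin.last (2 * M) := by
      rw [h0]
      intro h
      have := congrArg Fin.val h
      rw [Fin.val_zero, Fin.val_last] at this
      omega
    rw [if_neg hl, zero_mul]
  · rw [if_neg h0, mul_zero]

/-- `P_{-M} P_M = 0` for `M ≥ 1`. [folklore] -/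
theorem truncBot_mul_truncTop (hM : 1 ≤ M) : truncBot M * truncTop M = 0 := by
  have h := congrArg transpose (truncTop_mul_truncBot M hM)
  rwa [transpose_mul, truncTop_transpose, truncBot_transpose, transpose_zero] at h

/-- `P_M² = P_M`, `P_{-M}² = P_{-M}`. [folklore] -/
theorem truncTop_mul_self : truncTop M * truncTop M = truncTop M := by
  rw [truncTop, diagonal_mul_diagonal]
  congr 1
  funext a
  split_ifs <;> simp

/-- `P_{-M}² = P_{-M}`. [folklore] -/
theorem truncBot_mul_self : truncBot M * truncBot M = truncBot M := by
  rw [truncBot, diagonal_mul_diagonal]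
  congr 1
  funext a
  split_ifs <;> simp

/-- **`[N, cos] = i sin`** (exact also after truncation: `[N, U] = U`, `[N, Uᵀ] = -Uᵀ`).
[cite: WojtkiewiczPuszStachura2016, §3.4] -/
theorem lie_truncMomentum_truncCos : ⁅truncMomentum M, truncCos M⁆ = I • truncSin M := by
  rw [Ring.lie_def, I_smul_truncSin, truncCos, Matrix.mul_smul, Matrix.smul_mul, ← smul_sub,
    Matrix.mul_add, Matrix.add_mul, truncMomentum_mul_truncRaise,
    truncRaise_transpose_mul_truncMomentum]
  congr 1
  abel

/-- The purely algebraic skeleton of the kinetic double commutator: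
`[T, [N², T]] = -2 [N,T]² + (N [T,[N,T]] + [T,[N,T]] N)` in any ring. [folklore] -/
theorem lie_lie_mul_self {R : Type*} [Ring R] (N T : R) :
    ⁅T, ⁅N * N, T⁆⁆ = -(2 • (⁅N, T⁆ * ⁅N, T⁆)) + (N * ⁅T, ⁅N, T⁆⁆ + ⁅T, ⁅N, T⁆⁆ * N) := by
  simp only [Ring.lie_def]
  noncomm_ring

/-- `[cos, i sin] = -½(P_M - P_{-M})`. [folklore] -/
theorem lie_truncCos_I_smul_truncSin :
    ⁅truncCos M, I • truncSin M⁆ = (-(1 / 2 : ℂ)) • (truncTop M - truncBot M) := by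
  rw [lie_smul, Ring.lie_def, truncCos_mul_truncSin_sub, smul_smul, ← mul_div_assoc,
    Complex.I_mul_I, neg_div]

/-- **The kinetic double commutator of one truncated rotator**:
`[cos, [N², cos]] = 2 sin² - M (P_M + P_{-M})` (in the continuum, `2 sin²`; the defect lives on
the extreme momenta). [cite: WojtkiewiczPuszStachura2016, §3.4] [cite: KLS1988JSP, eq. (13)] -/
theorem truncCos_doubleCommutator :
    ⁅truncCos M, ⁅truncMomentum M * truncMomentum M, truncCos M⁆⁆ =
      (2 : ℂ) • (truncSin M * truncSin M) - (M : ℂ) • (truncTop M + truncBot M) := by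
  rw [lie_lie_mul_self, lie_truncMomentum_truncCos, lie_truncCos_I_smul_truncSin, smul_mul_smul_comm,
    Complex.I_mul_I, Matrix.mul_smul, Matrix.smul_mul, ← smul_add, Matrix.mul_sub, Matrix.sub_mul,
    truncMomentum_mul_truncTop, truncMomentum_mul_truncBot, truncTop_mul_truncMomentum,
    truncBot_mul_truncMomentum]
  module

/-! #### Order: `sin² ≤ 1`, `cos² ≤ 1`, the kinetic double commutator is `≤ 2` -/

/-- `1 - sin² = cos² + ½(P_M + P_{-M}) ≥ 0`. [folklore] -/
theorem posSemidef_one_sub_truncSin_sq : (1 - truncSin M * truncSin M).PosSemidef := by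
  have h : 1 - truncSin M * truncSin M =
      truncCos M * truncCos M + (1 / 2 : ℂ) • (truncTop M + truncBot M) := by
    rw [show (1 : Matrix (Fin (2 * M + 1)) (Fin (2 * M + 1)) ℂ) =
      truncCos M * truncCos M + truncSin M * truncSin M + (1 / 2 : ℂ) • (truncTop M + truncBot M) by
        rw [truncCos_sq_add_truncSin_sq, sub_add_cancel]]
    abel
  rw [h]
  refine Matrix.PosSemidef.add ?_ (((posSemidef_truncTop M).add (posSemidef_truncBot M)).smul
    (by rw [show (1 / 2 : ℂ) = ((1 / 2 : ℝ) : ℂ) by norm_num]; exact Complex.zero_le_real.2 (by norm_num)))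
  nth_rewrite 1 [← (truncSin_isHermitian M).eq] at *
  nth_rewrite 1 [← (truncCos_isHermitian M).eq]
  exact posSemidef_conjTranspose_mul_self _

/-- `1 - cos² = sin² + ½(P_M + P_{-M}) ≥ 0`. [folklore] -/
theorem posSemidef_one_sub_truncCos_sq : (1 - truncCos M * truncCos M).PosSemidef := by
  have h : 1 - truncCos M * truncCos M =
      truncSin M * truncSin M + (1 / 2 : ℂ) • (truncTop M + truncBot M) := by
    rw [show (1 : Matrix (Fin (2 * M + 1)) (Fin (2 * M + 1)) ℂ) =
      truncCos M * truncCos M + truncSin M * truncSin M + (1 / 2 : ℂ) • (truncTop M + truncBot M) by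
        rw [truncCos_sq_add_truncSin_sq, sub_add_cancel]]
    abel
  rw [h]
  refine Matrix.PosSemidef.add ?_ (((posSemidef_truncTop M).add (posSemidef_truncBot M)).smul
    (by rw [show (1 / 2 : ℂ) = ((1 / 2 : ℝ) : ℂ) by norm_num]; exact Complex.zero_le_real.2 (by norm_num)))
  nth_rewrite 1 [← (truncSin_isHermitian M).eq]
  exact posSemidef_conjTranspose_mul_self _

/-- `2·1 - (2 sin² - M(P_M + P_{-M})) = 2(1 - sin²) + M(P_M + P_{-M}) ≥ 0`: the kinetic double
commutator is at most `2`. [folklore] -/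
theorem posSemidef_two_sub_doubleCommutator :
    ((2 : ℂ) • (1 : Matrix (Fin (2 * M + 1)) (Fin (2 * M + 1)) ℂ) -
      ((2 : ℂ) • (truncSin M * truncSin M) - (M : ℂ) • (truncTop M + truncBot M))).PosSemidef := by
  have h : (2 : ℂ) • (1 : Matrix (Fin (2 * M + 1)) (Fin (2 * M + 1)) ℂ) -
      ((2 : ℂ) • (truncSin M * truncSin M) - (M : ℂ) • (truncTop M + truncBot M)) =
      (2 : ℂ) • (1 - truncSin M * truncSin M) + (M : ℂ) • (truncTop M + truncBot M) := by
    rw [smul_sub]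
    abel
  rw [h]
  refine ((posSemidef_one_sub_truncSin_sq M).smul ?_).add
    (((posSemidef_truncTop M).add (posSemidef_truncBot M)).smul ?_)
  · rw [show (2 : ℂ) = ((2 : ℝ) : ℂ) by norm_num]; exact Complex.zero_le_real.2 (by norm_num)
  · rw [show (M : ℂ) = ((M : ℝ) : ℂ) by norm_num]; exact Complex.zero_le_real.2 (Nat.cast_nonneg M)

end Local

/-! ### Many rotators: the double commutator of `H_M` with a wave `A = Σ_u a_u cos_u` -/

section Lattice

variable (M : ℕ) {Λ : Type*} [Fintype Λ] [DecidableEq Λ]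

/-- The on-site commutator `E_x = [cos_x, sin_x]` (`= (i/2)(P^x_M - P^x_{-M})`, an edge operator).
[folklore] -/
theorem lie_siteCos_siteSin (x : Λ) :
    ⁅siteCos M x, siteSin M x⁆ = onSite x ⁅truncCos M, truncSin M⁆ := by
  rw [Ring.lie_def, Ring.lie_def, siteCos, siteSin, onSite_mul, onSite_mul, onSite_sub']

/-- `E_x = (i/2)(P^x_M - P^x_{-M})`. [folklore] -/
theorem lie_siteCos_siteSin_eq (x : Λ) :
    ⁅siteCos M x, siteSin M x⁆ = (I / 2 : ℂ) • (onSite x (truncTop M) - onSite x (truncBot M)) := by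
  rw [Ring.lie_def, siteCos_mul_siteSin_sub]

/-- Operators of one rotator placed at distinct sites commute (as a `Commute` statement).
[folklore] -/
theorem commute_onSite_of_ne {q : ℕ} {x y : Λ} (hxy : x ≠ y) (a b : Matrix (Fin q) (Fin q) ℂ) :
    Commute (onSite x a : Op Λ q) (onSite y b) :=
  onSite_mul_onSite_comm hxy a b

/-- `[onSite x a, onSite x b] = onSite x [a, b]`. [folklore] -/
theorem lie_onSite_onSite {q : ℕ} (x : Λ) (a b : Matrix (Fin q) (Fin q) ℂ) :
    ⁅(onSite x a : Op Λ q), onSite x b⁆ = onSite x ⁅a, b⁆ := by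
  rw [Ring.lie_def, Ring.lie_def, onSite_mul, onSite_mul, onSite_sub']

/-- The kinetic double commutator at a site:
`[cos_x, [N_x², cos_x]] = 2 sin_x² - M Π_x`, `Π_x = P^x_M + P^x_{-M}`. [cite: KLS1988JSP, eq. (13)]
[cite: WojtkiewiczPuszStachura2016, §3.4] -/
theorem siteCos_doubleCommutator (x : Λ) :
    ⁅siteCos M x, ⁅siteMomentumSq M x, siteCos M x⁆⁆ =
      (2 : ℂ) • (siteSin M x * siteSin M x) - (M : ℂ) • (onSite x (truncTop M) + onSite x (truncBot M)) := by
  rw [siteCos, siteMomentumSq, lie_onSite_onSite, lie_onSite_onSite, truncCos_doubleCommutator,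
    onSite_sub', onSite_smul', onSite_smul', onSite_add', ← onSite_mul, siteSin]

/-- **Kinetic part.** For `A = Σ_u a_u cos_u`,
`[A, [Σ_x c N_x², A]] = Σ_x c a_x² [cos_x, [N_x², cos_x]]` (only the diagonal terms survive).
[folklore] -/
theorem lie_lie_kinetic (c : ℂ) (a : Λ → ℂ) :
    ⁅(∑ u : Λ, a u • siteCos M u), ⁅∑ x : Λ, c • siteMomentumSq M x, ∑ u : Λ, a u • siteCos M u⁆⁆ =
      ∑ x : Λ, c • (a x ^ 2 • ⁅siteCos M x, ⁅siteMomentumSq M x, siteCos M x⁆⁆) := by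
  -- `[K_x, A] = a_x [K_x, cos_x]`
  have h1 : ∀ x : Λ, ⁅siteMomentumSq M x, ∑ u : Λ, a u • siteCos M u⁆ =
      a x • ⁅siteMomentumSq M x, siteCos M x⁆ := by
    intro x
    rw [lie_sum, Fintype.sum_eq_single x (fun u hu => by
      rw [lie_smul, (commute_onSite_of_ne (Ne.symm hu) _ _).lie_eq, smul_zero]), lie_smul]
  -- `[cos_u, [K_x, cos_x]] = 0` for `u ≠ x`
  have h2 : ∀ x : Λ, ⁅(∑ u : Λ, a u • siteCos M u), ⁅siteMomentumSq M x, siteCos M x⁆⁆ =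
      a x • ⁅siteCos M x, ⁅siteMomentumSq M x, siteCos M x⁆⁆ := by
    intro x
    rw [sum_lie, Fintype.sum_eq_single x (fun u hu => by
      simp only [siteMomentumSq, siteCos, lie_onSite_onSite]
      rw [smul_lie, (commute_onSite_of_ne hu _ _).lie_eq, smul_zero]), smul_lie]
  have hKA : ⁅∑ x : Λ, c • siteMomentumSq M x, ∑ u : Λ, a u • siteCos M u⁆ =
      ∑ x : Λ, (c * a x) • ⁅siteMomentumSq M x, siteCos M x⁆ := by
    rw [sum_lie]
    refine sum_congr rfl fun x _ => ?_
    rw [smul_lie, h1, smul_smul]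
  rw [hKA, lie_sum]
  refine sum_congr rfl fun x _ => ?_
  rw [lie_smul, h2, smul_smul, smul_smul]
  congr 1
  ring

variable {M}

/-- For `x ≠ y`, `truncBond = cos_x cos_y + sin_x sin_y` with commuting factors; its commutators
with the cosines: `[B, cos_x] = -E_x sin_y`, `[B, cos_y] = -sin_x E_y`, `[B, cos_v] = 0` else.
[folklore] -/
theorem lie_truncBond_siteCos_left {x y : Λ} (hxy : x ≠ y) :
    ⁅truncBond M x y, siteCos M x⁆ = -(⁅siteCos M x, siteSin M x⁆ * siteSin M y) := by
  rw [truncBond, add_lie, ← lie_skew (siteCos M x * siteCos M y) (siteCos M x), siteCos, siteCos,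
    lie_mul_of_commute_right _ (commute_onSite_of_ne hxy _ _), lie_self, zero_mul,
    neg_zero, zero_add, ← lie_skew, siteSin, siteSin,
    lie_mul_of_commute_right _ (commute_onSite_of_ne hxy _ _)]

/-- `[B, cos_y] = -sin_x E_y`. [folklore] -/
theorem lie_truncBond_siteCos_right {x y : Λ} (hxy : x ≠ y) :
    ⁅truncBond M x y, siteCos M y⁆ = -(siteSin M x * ⁅siteCos M y, siteSin M y⁆) := by
  rw [truncBond, add_lie, ← lie_skew (siteCos M x * siteCos M y) (siteCos M y), siteCos, siteCos,
    lie_mul_of_commute_left _ (commute_onSite_of_ne (Ne.symm hxy) _ _), lie_self,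
    mul_zero, neg_zero, zero_add, ← lie_skew, siteSin, siteSin,
    lie_mul_of_commute_left _ (commute_onSite_of_ne (Ne.symm hxy) _ _)]

/-- `[B_{xy}, cos_v] = 0` off the bond. [folklore] -/
theorem lie_truncBond_siteCos_of_ne {x y v : Λ} (hvx : v ≠ x) (hvy : v ≠ y) :
    ⁅truncBond M x y, siteCos M v⁆ = 0 := by
  refine Commute.lie_eq ?_
  exact ((commute_onSite_of_ne hvx.symm _ _).mul_left (commute_onSite_of_ne hvy.symm _ _)).add_left
    ((commute_onSite_of_ne hvx.symm _ _).mul_left (commute_onSite_of_ne hvy.symm _ _))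

/-- **The bond double commutator.** For `x ≠ y`, `B = cos_x cos_y + sin_x sin_y` and
`A = Σ_u a_u cos_u`:
`[A, [B, A]] = -(a_x² [cos_x, E_x] sin_y + a_y² sin_x [cos_y, E_y] + 2 a_x a_y E_x E_y)`,
`E = [cos, sin]` — zero in the continuum, an edge term after truncation.
[cite: KLS1988JSP, eq. (13)] -/
theorem lie_lie_truncBond (a : Λ → ℂ) {x y : Λ} (hxy : x ≠ y) :
    ⁅(∑ u : Λ, a u • siteCos M u), ⁅truncBond M x y, ∑ u : Λ, a u • siteCos M u⁆⁆ =
      -(a x ^ 2 • (⁅siteCos M x, ⁅siteCos M x, siteSin M x⁆⁆ * siteSin M y) +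
        a y ^ 2 • (siteSin M x * ⁅siteCos M y, ⁅siteCos M y, siteSin M y⁆⁆) +
        (2 * a x * a y) • (⁅siteCos M x, siteSin M x⁆ * ⁅siteCos M y, siteSin M y⁆)) := by
  -- notation
  set Tx : Op Λ (2 * M + 1) := siteCos M x
  set Ty : Op Λ (2 * M + 1) := siteCos M y
  set Sx : Op Λ (2 * M + 1) := siteSin M x
  set Sy : Op Λ (2 * M + 1) := siteSin M y
  have hEx : ⁅Tx, Sx⁆ = onSite x ⁅truncCos M, truncSin M⁆ := lie_siteCos_siteSin M x
  have hEy : ⁅Ty, Sy⁆ = onSite y ⁅truncCos M, truncSin M⁆ := lie_siteCos_siteSin M y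
  set Ex : Op Λ (2 * M + 1) := ⁅Tx, Sx⁆
  set Ey : Op Λ (2 * M + 1) := ⁅Ty, Sy⁆
  -- `[B, A] = -a_x E_x S_y - a_y S_x E_y`
  have hBA : ⁅truncBond M x y, ∑ u : Λ, a u • siteCos M u⁆ =
      -(a x • (Ex * Sy)) - a y • (Sx * Ey) := by
    rw [lie_sum, Fintype.sum_eq_add x y hxy (fun v hv => by
      rw [lie_smul, lie_truncBond_siteCos_of_ne hv.1 hv.2, smul_zero]), lie_smul, lie_smul,
      lie_truncBond_siteCos_left hxy, lie_truncBond_siteCos_right hxy, smul_neg, smul_neg,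
      sub_eq_add_neg]
  -- second commutators
  have cxy : ∀ (p q : Matrix (Fin (2 * M + 1)) (Fin (2 * M + 1)) ℂ),
      Commute (onSite x p : Op Λ (2 * M + 1)) (onSite y q) := fun p q => commute_onSite_of_ne hxy p q
  have h1 : ⁅Tx, Ex * Sy⁆ = ⁅Tx, Ex⁆ * Sy := by
    rw [hEx]
    exact lie_mul_of_commute_right _ (cxy _ _)
  have h2 : ⁅Tx, Sx * Ey⁆ = Ex * Ey := by
    rw [hEy]
    exact lie_mul_of_commute_right _ (cxy _ _)
  have h3 : ⁅Ty, Ex * Sy⁆ = Ex * Ey := by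
    rw [hEx]
    exact lie_mul_of_commute_left _ (cxy _ _).symm
  have h4 : ⁅Ty, Sx * Ey⁆ = Sx * ⁅Ty, Ey⁆ :=
    lie_mul_of_commute_left _ (cxy _ _).symm
  have h0 : ∀ u, u ≠ x ∧ u ≠ y → ⁅siteCos M u, -(a x • (Ex * Sy)) - a y • (Sx * Ey)⁆ = 0 := by
    rintro u ⟨hux, huy⟩
    refine Commute.lie_eq ?_
    rw [hEx, hEy]
    exact ((((commute_onSite_of_ne hux _ _).mul_right (commute_onSite_of_ne huy _ _)).smul_right _).neg_right).sub_right
      (((commute_onSite_of_ne hux _ _).mul_right (commute_onSite_of_ne huy _ _)).smul_right _)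
  rw [hBA, sum_lie, Fintype.sum_eq_add x y hxy (fun u hu => by rw [smul_lie, h0 u hu, smul_zero]),
    smul_lie, smul_lie, lie_sub, lie_sub, lie_neg, lie_neg, lie_smul, lie_smul, lie_smul, lie_smul,
    h1, h2, h3, h4]
  module

variable (M)

/-- **The double commutator of the compressed Hamiltonian with a wave of cosines**
(rotator version of [KLS1988JSP] eq. (13)): for an irreflexive neighbour relation and
`A = Σ_u a_u cos_u`,
`[A, [H_M, A]] = Σ_x (h/2) a_x² (2 sin_x² - M Π_x)
  + (J/2) Σ_x Σ_{y ∼ x} (a_x² [cos_x, E_x] sin_y + a_y² sin_x [cos_y, E_y] + 2 a_x a_y E_x E_y)`.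
[cite: KLS1988JSP, eq. (13)] [cite: WojtkiewiczPuszStachura2016, §3.4] -/
theorem lie_lie_truncHamiltonian (nn : Λ → Λ → Prop) [DecidableRel nn] (hnn : ∀ x, ¬ nn x x)
    (h J : ℝ) (a : Λ → ℂ) :
    ⁅(∑ u : Λ, a u • siteCos M u), ⁅truncHamiltonian M nn h J, ∑ u : Λ, a u • siteCos M u⁆⁆ =
      ∑ x : Λ, ((h / 2 : ℝ) : ℂ) • (a x ^ 2 •
        ((2 : ℂ) • (siteSin M x * siteSin M x) - (M : ℂ) • (onSite x (truncTop M) + onSite x (truncBot M)))) +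
      ∑ x : Λ, ∑ y ∈ univ.filter (nn x), ((J / 2 : ℝ) : ℂ) •
        (a x ^ 2 • (⁅siteCos M x, ⁅siteCos M x, siteSin M x⁆⁆ * siteSin M y) +
          a y ^ 2 • (siteSin M x * ⁅siteCos M y, ⁅siteCos M y, siteSin M y⁆⁆) +
          (2 * a x * a y) • (⁅siteCos M x, siteSin M x⁆ * ⁅siteCos M y, siteSin M y⁆)) := by
  rw [truncHamiltonian, sub_lie, lie_sub, lie_lie_kinetic]
  simp only [siteCos_doubleCommutator]
  rw [sub_eq_add_neg]
  congr 1
  have hin : ⁅∑ x : Λ, ∑ y ∈ univ.filter (nn x), ((J / 2 : ℝ) : ℂ) • truncBond M x y,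
      ∑ u : Λ, a u • siteCos M u⁆ =
      ∑ x : Λ, ∑ y ∈ univ.filter (nn x), ⁅((J / 2 : ℝ) : ℂ) • truncBond M x y,
        ∑ u : Λ, a u • siteCos M u⁆ := by
    rw [sum_lie]
    refine sum_congr rfl fun x _ => ?_
    rw [sum_lie]
  rw [hin, lie_sum, ← sum_neg_distrib]
  refine sum_congr rfl fun x _ => ?_
  rw [lie_sum, ← sum_neg_distrib]
  refine sum_congr rfl fun y hy => ?_
  have hxy : x ≠ y := fun h => hnn x (h ▸ (mem_filter.1 hy).2)
  rw [smul_lie, lie_smul, lie_lie_truncBond a hxy, smul_neg, neg_neg]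

/-! ### Order: the operator inequalities controlling the edge terms -/

/-- `(εAAᴴ + ε⁻¹BᴴB) ± (AB + BᴴAᴴ) ≥ 0` for `ε > 0` (it is `XᴴX` for `X = √ε Aᴴ ± (1/√ε) B`).
[folklore] -/
theorem posSemidef_smul_add_smul_sub {m : Type*} [Fintype m] (A B : Matrix m m ℂ) {ε : ℝ}
    (hε : 0 < ε) :
    (((ε : ℂ) • (A * Aᴴ) + ((ε⁻¹ : ℝ) : ℂ) • (Bᴴ * B)) - (A * B + Bᴴ * Aᴴ)).PosSemidef ∧
      (((ε : ℂ) • (A * Aᴴ) + ((ε⁻¹ : ℝ) : ℂ) • (Bᴴ * B)) + (A * B + Bᴴ * Aᴴ)).PosSemidef := by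
  have hs : Real.sqrt ε * Real.sqrt ε = ε := Real.mul_self_sqrt hε.le
  have hs' : (Real.sqrt ε)⁻¹ * (Real.sqrt ε)⁻¹ = ε⁻¹ := by rw [← mul_inv, hs]
  have hs1 : Real.sqrt ε * (Real.sqrt ε)⁻¹ = 1 := mul_inv_cancel₀ (Real.sqrt_pos.2 hε).ne'
  have key : ∀ s : ℝ, s * s = 1 →
      (((ε : ℂ) • (A * Aᴴ) + ((ε⁻¹ : ℝ) : ℂ) • (Bᴴ * B)) + (s : ℂ) • (A * B + Bᴴ * Aᴴ)).PosSemidef := by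
    intro s hs2
    have h := posSemidef_conjTranspose_mul_self
      (((Real.sqrt ε : ℝ) : ℂ) • Aᴴ + ((s * (Real.sqrt ε)⁻¹ : ℝ) : ℂ) • B)
    have e : (((Real.sqrt ε : ℝ) : ℂ) • Aᴴ + ((s * (Real.sqrt ε)⁻¹ : ℝ) : ℂ) • B)ᴴ *
        (((Real.sqrt ε : ℝ) : ℂ) • Aᴴ + ((s * (Real.sqrt ε)⁻¹ : ℝ) : ℂ) • B) =
        ((ε : ℂ) • (A * Aᴴ) + ((ε⁻¹ : ℝ) : ℂ) • (Bᴴ * B)) + (s : ℂ) • (A * B + Bᴴ * Aᴴ) := by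
      rw [conjTranspose_add, conjTranspose_smul, conjTranspose_smul, conjTranspose_conjTranspose]
      simp only [Complex.star_def, Complex.conj_ofReal]
      rw [add_mul,
        mul_add, mul_add, smul_mul_smul_comm, smul_mul_smul_comm, smul_mul_smul_comm,
        smul_mul_smul_comm, ← Complex.ofReal_mul, ← Complex.ofReal_mul, ← Complex.ofReal_mul,
        ← Complex.ofReal_mul, hs, show Real.sqrt ε * (s * (Real.sqrt ε)⁻¹) = s by
          rw [mul_left_comm, hs1, mul_one], show s * (Real.sqrt ε)⁻¹ * Real.sqrt ε = s by
          rw [mul_assoc, inv_mul_cancel₀ (Real.sqrt_pos.2 hε).ne', mul_one],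
        show s * (Real.sqrt ε)⁻¹ * (s * (Real.sqrt ε)⁻¹) = ε⁻¹ by
          rw [mul_mul_mul_comm, hs2, one_mul, hs'], smul_add]
      abel
    rwa [e] at h
  constructor
  · have h := key (-1) (by norm_num)
    rwa [Complex.ofReal_neg, Complex.ofReal_one, neg_one_smul, ← sub_eq_add_neg] at h
  · have h := key 1 (by norm_num)
    rwa [Complex.ofReal_one, one_smul] at h

/-! #### The edge projection `Π_x = P^x_M + P^x_{-M}` and the edge operator `E_x = [cos_x, sin_x]` -/

/-- The edge projection `Π_x = P^x_M + P^x_{-M}` onto the extreme momenta at site `x`. [folklore] -/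
def siteEdgeProj (x : Λ) : Op Λ (2 * M + 1) := onSite x (truncTop M) + onSite x (truncBot M)

/-- `Π_x = onSite x (P_M + P_{-M})`. [folklore] -/
theorem siteEdgeProj_eq (x : Λ) : siteEdgeProj M x = onSite x (truncTop M + truncBot M) := by
  rw [siteEdgeProj, onSite_add']

/-- `Π_x` is Hermitian. [folklore] -/
theorem siteEdgeProj_isHermitian (x : Λ) : (siteEdgeProj M x).IsHermitian := by
  rw [siteEdgeProj_eq]
  exact onSite_isHermitian x ((truncTop_isHermitian M).add (truncBot_isHermitian M))

/-- `Π_x ≥ 0`. [folklore] -/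
theorem posSemidef_siteEdgeProj (x : Λ) : (siteEdgeProj M x).PosSemidef :=
  (posSemidef_onSite_truncTop M x).add (posSemidef_onSite_truncBot M x)

/-- `(P_M + P_{-M})² = P_M + P_{-M}` for `M ≥ 1`. [folklore] -/
theorem truncTop_add_truncBot_mul_self (hM : 1 ≤ M) :
    (truncTop M + truncBot M) * (truncTop M + truncBot M) = truncTop M + truncBot M := by
  rw [Matrix.add_mul, Matrix.mul_add, Matrix.mul_add, truncTop_mul_self, truncBot_mul_self,
    truncTop_mul_truncBot M hM, truncBot_mul_truncTop M hM, add_zero, zero_add]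

/-- `(P_M - P_{-M})² = P_M + P_{-M}` for `M ≥ 1`. [folklore] -/
theorem truncTop_sub_truncBot_mul_self (hM : 1 ≤ M) :
    (truncTop M - truncBot M) * (truncTop M - truncBot M) = truncTop M + truncBot M := by
  rw [Matrix.sub_mul, Matrix.mul_sub, Matrix.mul_sub, truncTop_mul_self, truncBot_mul_self,
    truncTop_mul_truncBot M hM, truncBot_mul_truncTop M hM, sub_zero, zero_sub, sub_neg_eq_add]

/-- `Π_x² = Π_x` for `M ≥ 1`. [folklore] -/
theorem siteEdgeProj_mul_self (hM : 1 ≤ M) (x : Λ) :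
    siteEdgeProj M x * siteEdgeProj M x = siteEdgeProj M x := by
  rw [siteEdgeProj_eq, onSite_mul, truncTop_add_truncBot_mul_self M hM]

/-- `M² Π_x ≤ N_x²` (Chebyshev). [folklore] -/
theorem posSemidef_siteMomentumSq_sub_siteEdgeProj (x : Λ) :
    (siteMomentumSq M x - ((M : ℂ) ^ 2) • siteEdgeProj M x).PosSemidef :=
  posSemidef_siteMomentumSq_sub M x

/-- `E_xᴴ = -E_x` (`E_x = (i/2)(P^x_M - P^x_{-M})`). [folklore] -/
theorem lie_siteCos_siteSin_conjTranspose (x : Λ) :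
    (⁅siteCos M x, siteSin M x⁆)ᴴ = -⁅siteCos M x, siteSin M x⁆ := by
  rw [lie_siteCos_siteSin_eq, conjTranspose_smul, conjTranspose_sub, ← onSite_conjTranspose,
    ← onSite_conjTranspose, (truncTop_isHermitian M).eq, (truncBot_isHermitian M).eq, ← neg_smul]
  congr 1
  simp [Complex.conj_I, neg_div]

/-- `E_x² = -¼ Π_x` for `M ≥ 1`. [folklore] -/
theorem lie_siteCos_siteSin_mul_self (hM : 1 ≤ M) (x : Λ) :
    ⁅siteCos M x, siteSin M x⁆ * ⁅siteCos M x, siteSin M x⁆ = (-(1 / 4 : ℂ)) • siteEdgeProj M x := by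
  rw [lie_siteCos_siteSin_eq, ← onSite_sub', smul_mul_smul_comm, onSite_mul,
    truncTop_sub_truncBot_mul_self M hM, ← siteEdgeProj_eq]
  congr 1
  rw [div_mul_div_comm, Complex.I_mul_I]
  norm_num

/-- `[cos_x, E_x] sin_y = W + Wᴴ` with `W = cos_x (E_x sin_y)`, for `x ≠ y`. [folklore] -/
theorem lie_lie_mul_siteSin_eq {x y : Λ} (hxy : x ≠ y) :
    ⁅siteCos M x, ⁅siteCos M x, siteSin M x⁆⁆ * siteSin M y =
      siteCos M x * (⁅siteCos M x, siteSin M x⁆ * siteSin M y) +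
        (⁅siteCos M x, siteSin M x⁆ * siteSin M y)ᴴ * (siteCos M x)ᴴ := by
  have hc1 : siteSin M y * ⁅siteCos M x, siteSin M x⁆ = ⁅siteCos M x, siteSin M x⁆ * siteSin M y := by
    rw [lie_siteCos_siteSin, siteSin]
    exact (commute_onSite_of_ne hxy _ _).eq.symm
  have hc2 : siteSin M y * siteCos M x = siteCos M x * siteSin M y :=
    (commute_onSite_of_ne hxy _ _).eq.symm
  rw [conjTranspose_mul, (siteSin_isHermitian M y).eq, (siteCos_isHermitian M x).eq,
    lie_siteCos_siteSin_conjTranspose, Matrix.mul_neg, Matrix.neg_mul, hc1,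
    Matrix.mul_assoc _ (siteSin M y), hc2]
  set E := ⁅siteCos M x, siteSin M x⁆
  rw [Ring.lie_def]
  noncomm_ring

/-- **The edge term `[cos_x, E_x] sin_y` is small in every state**: for `x ≠ y`, `M ≥ 1` and
`ε > 0`, `±([cos_x, E_x] sin_y) ≤ ε + Π_x/(4ε)` as operators. [folklore] -/
theorem posSemidef_edgeTerm (hM : 1 ≤ M) {x y : Λ} (hxy : x ≠ y) {ε : ℝ} (hε : 0 < ε) :
    ((ε : ℂ) • (1 : Op Λ (2 * M + 1)) + ((ε⁻¹ / 4 : ℝ) : ℂ) • siteEdgeProj M x -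
        ⁅siteCos M x, ⁅siteCos M x, siteSin M x⁆⁆ * siteSin M y).PosSemidef ∧
      ((ε : ℂ) • (1 : Op Λ (2 * M + 1)) + ((ε⁻¹ / 4 : ℝ) : ℂ) • siteEdgeProj M x +
        ⁅siteCos M x, ⁅siteCos M x, siteSin M x⁆⁆ * siteSin M y).PosSemidef := by
  set A : Op Λ (2 * M + 1) := siteCos M x with hA
  set B : Op Λ (2 * M + 1) := ⁅siteCos M x, siteSin M x⁆ * siteSin M y with hB
  obtain ⟨h1, h2⟩ := posSemidef_smul_add_smul_sub A B hε
  have hW := lie_lie_mul_siteSin_eq (M := M) hxy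
  -- `A Aᴴ = cos_x² ≤ 1`
  have hAA : ((1 : Op Λ (2 * M + 1)) - A * Aᴴ).PosSemidef := by
    rw [hA, (siteCos_isHermitian M x).eq, siteCos, onSite_mul, ← onSite_one', ← onSite_sub']
    exact onSite_posSemidef x (posSemidef_one_sub_truncCos_sq M)
  -- `Bᴴ B = ¼ Π_x sin_y² ≤ ¼ Π_x`
  have hBB : ((((1 / 4 : ℝ) : ℂ)) • siteEdgeProj M x - Bᴴ * B).PosSemidef := by
    have hcomm : siteSin M y * siteEdgeProj M x = siteEdgeProj M x * siteSin M y := by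
      rw [siteEdgeProj_eq, siteSin]
      exact (commute_onSite_of_ne hxy _ _).eq.symm
    have hcommE : siteSin M y * ⁅siteCos M x, siteSin M x⁆ = ⁅siteCos M x, siteSin M x⁆ * siteSin M y := by
      rw [lie_siteCos_siteSin, siteSin]
      exact (commute_onSite_of_ne hxy _ _).eq.symm
    have hB' : Bᴴ = -(siteSin M y * ⁅siteCos M x, siteSin M x⁆) := by
      rw [hB, conjTranspose_mul, (siteSin_isHermitian M y).eq, lie_siteCos_siteSin_conjTranspose,
        Matrix.mul_neg]
    have hBB' : Bᴴ * B = ((1 / 4 : ℝ) : ℂ) • (siteEdgeProj M x * (siteSin M y * siteSin M y)) := by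
      have e1 : Bᴴ * B = -(siteSin M y * (⁅siteCos M x, siteSin M x⁆ * ⁅siteCos M x, siteSin M x⁆) *
          siteSin M y) := by
        rw [hB', hB]
        noncomm_ring
      rw [e1, lie_siteCos_siteSin_mul_self M hM, Matrix.mul_smul, Matrix.smul_mul, ← neg_smul, neg_neg,
        hcomm, Matrix.mul_assoc]
      congr 1
      norm_num
    have hP : ((1 : Op Λ (2 * M + 1)) - siteSin M y * siteSin M y).PosSemidef := by
      rw [siteSin, onSite_mul, ← onSite_one', ← onSite_sub']
      exact onSite_posSemidef y (posSemidef_one_sub_truncSin_sq M)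
    have key : (siteEdgeProj M x - siteEdgeProj M x * (siteSin M y * siteSin M y)).PosSemidef := by
      have h3 := hP.conjTranspose_mul_mul_same (siteEdgeProj M x)
      have hc2' : siteSin M y * siteSin M y * siteEdgeProj M x =
          siteEdgeProj M x * (siteSin M y * siteSin M y) := by
        rw [Matrix.mul_assoc, hcomm, ← Matrix.mul_assoc, hcomm, Matrix.mul_assoc]
      rw [(siteEdgeProj_isHermitian M x).eq, Matrix.mul_sub, Matrix.sub_mul, Matrix.mul_one,
        siteEdgeProj_mul_self M hM, Matrix.mul_assoc, hc2', ← Matrix.mul_assoc,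
        siteEdgeProj_mul_self M hM] at h3
      exact h3
    rw [hBB', ← smul_sub]
    exact key.smul (Complex.zero_le_real.2 (by norm_num))
  have hε' : (0 : ℂ) ≤ (ε : ℂ) := Complex.zero_le_real.2 hε.le
  have hε'' : (0 : ℂ) ≤ ((ε⁻¹ : ℝ) : ℂ) := Complex.zero_le_real.2 (inv_nonneg.2 hε.le)
  have hsum : (ε : ℂ) • (1 : Op Λ (2 * M + 1)) + ((ε⁻¹ / 4 : ℝ) : ℂ) • siteEdgeProj M x =
      ((ε : ℂ) • (A * Aᴴ) + ((ε⁻¹ : ℝ) : ℂ) • (Bᴴ * B)) +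
        ((ε : ℂ) • (1 - A * Aᴴ) + ((ε⁻¹ : ℝ) : ℂ) • (((1 / 4 : ℝ) : ℂ) • siteEdgeProj M x - Bᴴ * B)) := by
    rw [smul_sub, smul_sub, smul_smul, ← Complex.ofReal_mul, show ε⁻¹ * (1 / 4) = ε⁻¹ / 4 by ring]
    abel
  have hWW : ⁅siteCos M x, ⁅siteCos M x, siteSin M x⁆⁆ * siteSin M y = A * B + Bᴴ * Aᴴ := hW
  constructor
  · rw [hsum, hWW, add_sub_right_comm]
    exact h1.add ((hAA.smul hε').add (hBB.smul hε''))
  · rw [hsum, hWW, add_right_comm]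
    exact h2.add ((hAA.smul hε').add (hBB.smul hε''))

/-- **The edge product `E_x E_y` is small in every state**: for `x ≠ y` and `M ≥ 1`,
`±(E_x E_y) ≤ (Π_x + Π_y)/8` as operators. [folklore] -/
theorem posSemidef_edgeProd (hM : 1 ≤ M) {x y : Λ} (hxy : x ≠ y) :
    (((1 / 8 : ℝ) : ℂ) • (siteEdgeProj M x + siteEdgeProj M y) -
        ⁅siteCos M x, siteSin M x⁆ * ⁅siteCos M y, siteSin M y⁆).PosSemidef ∧
      (((1 / 8 : ℝ) : ℂ) • (siteEdgeProj M x + siteEdgeProj M y) +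
        ⁅siteCos M x, siteSin M x⁆ * ⁅siteCos M y, siteSin M y⁆).PosSemidef := by
  -- `D_x = P^x_M - P^x_{-M}`: Hermitian, `D_x² = Π_x`, `E_x = (i/2) D_x`
  have hE : ⁅siteCos M x, siteSin M x⁆ * ⁅siteCos M y, siteSin M y⁆ =
      (-((1 / 4 : ℝ) : ℂ)) • (onSite x (truncTop M - truncBot M) * onSite y (truncTop M - truncBot M)) := by
    rw [lie_siteCos_siteSin_eq, lie_siteCos_siteSin_eq, ← onSite_sub', ← onSite_sub',
      smul_mul_smul_comm, div_mul_div_comm, Complex.I_mul_I]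
    norm_num
  set Dx : Op Λ (2 * M + 1) := onSite x (truncTop M - truncBot M) with hDx
  set Dy : Op Λ (2 * M + 1) := onSite y (truncTop M - truncBot M) with hDy
  have hDxh : Dxᴴ = Dx := by
    rw [hDx, ← onSite_conjTranspose, ((truncTop_isHermitian M).sub (truncBot_isHermitian M)).eq]
  have hDyh : Dyᴴ = Dy := by
    rw [hDy, ← onSite_conjTranspose, ((truncTop_isHermitian M).sub (truncBot_isHermitian M)).eq]
  have hDx2 : Dx * Dx = siteEdgeProj M x := by
    rw [hDx, onSite_mul, truncTop_sub_truncBot_mul_self M hM, siteEdgeProj_eq]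
  have hDy2 : Dy * Dy = siteEdgeProj M y := by
    rw [hDy, onSite_mul, truncTop_sub_truncBot_mul_self M hM, siteEdgeProj_eq]
  have hc : Dy * Dx = Dx * Dy := (commute_onSite_of_ne hxy _ _).eq.symm
  have key : ∀ s : ℝ, s * s = 1 →
      (((1 / 8 : ℝ) : ℂ) • (siteEdgeProj M x + siteEdgeProj M y) +
        ((s / 4 : ℝ) : ℂ) • (Dx * Dy)).PosSemidef := by
    intro s hs
    have h := posSemidef_conjTranspose_mul_self (Dx + (s : ℂ) • Dy)
    have e : (Dx + (s : ℂ) • Dy)ᴴ * (Dx + (s : ℂ) • Dy) =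
        (siteEdgeProj M x + siteEdgeProj M y) + ((2 * s : ℝ) : ℂ) • (Dx * Dy) := by
      rw [conjTranspose_add, conjTranspose_smul, hDxh, hDyh]
      simp only [Complex.star_def, Complex.conj_ofReal, add_mul, mul_add, Matrix.smul_mul,
        Matrix.mul_smul, smul_smul, hc, hDx2]
      rw [← Complex.ofReal_mul, hs, Complex.ofReal_one, one_smul, hDy2,
        show ((2 * s : ℝ) : ℂ) = (s : ℂ) + (s : ℂ) by push_cast; ring, add_smul]
      abel
    rw [e] at h
    have h' := h.smul (show (0 : ℂ) ≤ ((1 / 8 : ℝ) : ℂ) from Complex.zero_le_real.2 (by norm_num))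
    rw [smul_add, smul_smul, ← Complex.ofReal_mul, show (1 / 8 : ℝ) * (2 * s) = s / 4 by ring] at h'
    exact h'
  constructor
  · have h := key 1 (by norm_num)
    rw [hE, neg_smul, sub_neg_eq_add]
    exact h
  · have h := key (-1) (by norm_num)
    rw [show ((-1 : ℝ) / 4 : ℝ) = -(1 / 4 : ℝ) by norm_num, Complex.ofReal_neg, neg_smul,
      ← sub_eq_add_neg] at h
    rw [hE, neg_smul, ← sub_eq_add_neg]
    exact h

/-- The kinetic double commutator at a site is at most `2`: `2·1 - (2 sin_x² - M Π_x) ≥ 0`.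
[folklore] -/
theorem posSemidef_two_sub_siteCos_doubleCommutator (x : Λ) :
    ((2 : ℂ) • (1 : Op Λ (2 * M + 1)) -
      ((2 : ℂ) • (siteSin M x * siteSin M x) - (M : ℂ) • siteEdgeProj M x)).PosSemidef := by
  rw [siteEdgeProj_eq, siteSin, onSite_mul, ← onSite_smul', ← onSite_smul', ← onSite_one',
    ← onSite_smul', ← onSite_sub', ← onSite_sub']
  exact onSite_posSemidef x (posSemidef_two_sub_doubleCommutator M)

/-- `sin_x² ≤ 1`. [folklore] -/
theorem posSemidef_one_sub_siteSin_sq (x : Λ) :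
    ((1 : Op Λ (2 * M + 1)) - siteSin M x * siteSin M x).PosSemidef := by
  rw [siteSin, onSite_mul, ← onSite_one', ← onSite_sub']
  exact onSite_posSemidef x (posSemidef_one_sub_truncSin_sq M)

/-- `cos_x² ≤ 1`. [folklore] -/
theorem posSemidef_one_sub_siteCos_sq (x : Λ) :
    ((1 : Op Λ (2 * M + 1)) - siteCos M x * siteCos M x).PosSemidef := by
  rw [siteCos, onSite_mul, ← onSite_one', ← onSite_sub']
  exact onSite_posSemidef x (posSemidef_one_sub_truncCos_sq M)

end Lattice

end QuantumRotor

end Literature.MathematicalPhysics.QuantumLattice
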